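import Mathlib
import HarnessLib
import Summits.Parity.GeneralizedHardyLittlewood.Theses.LiouvilleMAD

/-!
# `TypeIILiouville` (stmt-Parity-13322): load-bearing shift, tight diagonal term, character caricature

Negative lemmas (the disprover's record, cycle 1) for the crux `LiouvilleMAD.TypeIILiouville`
(route LiouvilleMAD; power-saving Type II for `λ(mn+c)`, `1 ≤ N ≤ M`, arbitrary real coefficients):
in operator-norm form the crux reads `‖(λ(mn+c))_{m∈(M,2M], n∈(N,2N]}‖_op ≤ C(√M + √N·M^{1/2-η})`.
Writing `TypeIIShape f c` for the crux's inequality with a general weight `f` and shift `c`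
(`TypeIILiouville → ∀ c ≠ 0, TypeIIShape lam c`, definitional), we prove:

* (a) `not_typeIIShape_lam_zero` / `typeIILiouville_false_without_shift_ne_zero`: the hypothesis
  `c ≠ 0` is LOAD-BEARING — at `c = 0`, `λ(mn) = λ(m)λ(n)` is a rank-one sign matrix of norm
  `√(MN)` (witness `α = β = λ`, `M = N → ∞`).
* (b) `rankOne_ratio`, `not_typeIIShapeStrongN_lam`, `not_typeIILiouvilleStrongN`: the diagonal
  term `N^{-1/2}` is ATTAINED in every box (`β = δ_{N+1}`, `α_m = λ(m(N+1)+c)`: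
  `|B| = ‖α‖₂‖β‖₂√(MN)·N^{-1/2}` exactly), so the strengthening of the crux with `N^{-(1/2+δ)}`,
  `δ > 0`, is false at every shift.
* (c) `not_typeIIShape_chi4`: the crux's shape is FALSE at every shift when `λ` is replaced by the
  primitive character `χ₄` (completely multiplicative, mean zero, `{0,±1}`-valued): `χ₄(mn+c) = 1`
  on `m ≡ 1-c, n ≡ 1 (mod 4)`. So boundedness + complete multiplicativity + mean zero cannot prove
  the crux; a proof must separate `λ` from periodic characters with a POWER saving at scale `M^η`
  (the Landau–Siegel caricature, cf. line `Sketch`: `TypeIILiouville → quasi-RH`). [folklore]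
-/

namespace Summit.Parity.GeneralizedHardyLittlewood.Theorems.TypeIILiouville.Negative

open Finset Filter
open Summit.Parity.GeneralizedHardyLittlewood.Theses.LiouvilleMAD

/-! ## §1 The shape of the crux for a general weight -/

/-- The crux's inequality with a general arithmetic weight `f` in place of `λ` and shift `c`:
`∃ η > 0, C` such that for all `1 ≤ N ≤ M` and all real `α, β`,
`|Σ_{m∼M} Σ_{n∼N} α_m β_n f(mn+c)| ≤ C ‖α‖₂ ‖β‖₂ √(MN) (N^{-1/2} + M^{-η})`. -/
def TypeIIShape (f : ℕ → ℝ) (c : ℤ) : Prop :=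
  ∃ η : ℝ, 0 < η ∧ ∃ C : ℝ, ∀ M N : ℕ, 1 ≤ N → N ≤ M → ∀ α β : ℕ → ℝ,
    |∑ m ∈ Ioc M (2 * M), ∑ n ∈ Ioc N (2 * N), α m * β n * f (Int.toNat ((m : ℤ) * n + c))| ≤
      C * Real.sqrt (∑ m ∈ Ioc M (2 * M), α m ^ 2) * Real.sqrt (∑ n ∈ Ioc N (2 * N), β n ^ 2) *
        Real.sqrt ((M : ℝ) * N) * ((N : ℝ) ^ (-(1 / 2 : ℝ)) + (M : ℝ) ^ (-η))

/-- The Liouville function as a real weight. -/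
def lam (k : ℕ) : ℝ := (ArithmeticFunction.liouville k : ℝ)

/-- The crux is `TypeIIShape lam c` for every `c ≠ 0` (definitional; only this direction is
recorded here, so that no declaration of this file concludes the crux). -/
theorem typeIIShape_of_typeIILiouville (h : TypeIILiouville) : ∀ c : ℤ, c ≠ 0 → TypeIIShape lam c :=
  h

/-- Complete multiplicativity of `λ` (Mathlib `liouville_apply_mul`), as reals. -/
theorem lam_mul (m n : ℕ) : lam (m * n) = lam m * lam n := by
  simp [lam, ArithmeticFunction.liouville_apply_mul]

/-- `λ(k)² = 1` for `k ≠ 0`. -/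
theorem lam_mul_self {k : ℕ} (hk : k ≠ 0) : lam k * lam k = 1 := by
  simp only [lam, ArithmeticFunction.liouville_apply hk, Int.cast_pow, Int.cast_neg, Int.cast_one]
  rw [← pow_add, ← two_mul, pow_mul]
  simp

/-- `λ(k)^2 = 1` for `k ≠ 0`. -/
theorem lam_sq {k : ℕ} (hk : k ≠ 0) : lam k ^ 2 = 1 := by
  rw [sq, lam_mul_self hk]

/-- `C · u(L)^{-a} → 0` along any `u → ∞`: eventually below any `ε > 0`. -/
theorem eventually_const_mul_rpow_neg_lt (C : ℝ) {a ε : ℝ} (ha : 0 < a) (hε : 0 < ε)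
    {u : ℕ → ℝ} (hu : Tendsto u atTop atTop) :
    ∀ᶠ L : ℕ in atTop, C * (u L) ^ (-a) < ε := by
  have h := ((tendsto_rpow_neg_atTop ha).comp hu).const_mul C
  rw [mul_zero] at h
  exact h.eventually (gt_mem_nhds hε)

/-- The dyadic window `(M, 2M]` has `M` elements. -/
theorem card_Ioc_two_mul (M : ℕ) : (Ioc M (2 * M)).card = M := by
  rw [Nat.card_Ioc]; omega

/-! ## §2(a) LOAD-BEARING: the shift `c ≠ 0`

At `c = 0` the matrix `λ(mn) = λ(m)λ(n)` is rank one of operator norm `√(MN)` (no cancellation at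
all against `α = β = λ`), so the crux's shape fails: ANY proof of the crux must use `c ≠ 0`. -/

/-- The crux's shape is false at shift `c = 0`. Witness: `α = β = λ`, `M = N → ∞`. -/
theorem not_typeIIShape_lam_zero : ¬ TypeIIShape lam 0 := by
  rintro ⟨η, hη, C, h⟩
  obtain ⟨M, hM1, hMa, hMb⟩ := ((eventually_ge_atTop 1).and
    ((eventually_const_mul_rpow_neg_lt C (by norm_num : (0 : ℝ) < 1 / 2) one_half_pos
      tendsto_natCast_atTop_atTop).and
    (eventually_const_mul_rpow_neg_lt C hη one_half_pos tendsto_natCast_atTop_atTop))).exists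
  have hbox := h M M hM1 le_rfl lam lam
  have hterm : ∀ m ∈ Ioc M (2 * M), ∀ n ∈ Ioc M (2 * M),
      lam m * lam n * lam (Int.toNat ((m : ℤ) * n + 0)) = 1 := by
    intro m hm n hn
    have hm0 : m ≠ 0 := by rw [mem_Ioc] at hm; omega
    have hn0 : n ≠ 0 := by rw [mem_Ioc] at hn; omega
    rw [add_zero, ← Nat.cast_mul, Int.toNat_natCast, lam_mul,
      show lam m * lam n * (lam m * lam n) = (lam m * lam m) * (lam n * lam n) by ring,
      lam_mul_self hm0, lam_mul_self hn0, mul_one]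
  have hsum : ∑ m ∈ Ioc M (2 * M), ∑ n ∈ Ioc M (2 * M),
      lam m * lam n * lam (Int.toNat ((m : ℤ) * n + 0)) = (M : ℝ) * M := by
    rw [sum_congr rfl fun m hm => sum_congr rfl fun n hn => hterm m hm n hn]
    simp only [sum_const, card_Ioc_two_mul, nsmul_eq_mul, mul_one]
  have hsq : ∑ m ∈ Ioc M (2 * M), lam m ^ 2 = (M : ℝ) := by
    rw [sum_congr rfl fun m hm => lam_sq (by rw [mem_Ioc] at hm; omega)]
    simp only [sum_const, card_Ioc_two_mul, nsmul_eq_mul, mul_one]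
  rw [hsum, hsq] at hbox
  have hMpos : (0 : ℝ) < M := by exact_mod_cast hM1
  have h1 : Real.sqrt (M : ℝ) * Real.sqrt M = M := Real.mul_self_sqrt hMpos.le
  have h2 : Real.sqrt ((M : ℝ) * M) = M := Real.sqrt_mul_self hMpos.le
  have hrhs : C * Real.sqrt (M : ℝ) * Real.sqrt M * Real.sqrt ((M : ℝ) * M) *
      ((M : ℝ) ^ (-(1 / 2 : ℝ)) + (M : ℝ) ^ (-η)) =
      (C * (M : ℝ) ^ (-(1 / 2 : ℝ)) + C * (M : ℝ) ^ (-η)) * ((M : ℝ) * M) := by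
    rw [show C * Real.sqrt (M : ℝ) * Real.sqrt M = C * (Real.sqrt M * Real.sqrt M) by ring, h1, h2]
    ring
  rw [hrhs, abs_of_nonneg (by positivity)] at hbox
  have hMM : (0 : ℝ) < M * M := by positivity
  nlinarith

/-- The crux with its hypothesis `c ≠ 0` DROPPED. -/
def TypeIILiouvilleWithoutShiftNeZero : Prop := ∀ c : ℤ, TypeIIShape lam c

/-- LOAD-BEARING (a): the crux without `c ≠ 0` is false (at `c = 0`). -/
theorem typeIILiouville_false_without_shift_ne_zero : ¬ TypeIILiouvilleWithoutShiftNeZero :=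
  fun h => not_typeIIShape_lam_zero (h 0)

/-! ## §2(b) TIGHTNESS: the diagonal term `N^{-1/2}` is attained in every box

Rank-one witness: `β = δ_{N+1}`, `α_m = λ(m(N+1)+c)`. Then `B = M = ‖α‖² `, `‖β‖ = 1`, so
`|B| / (‖α‖‖β‖√(MN)) = N^{-1/2}` exactly. Consequently the strengthening of the crux in which
`N^{-1/2}` is replaced by `N^{-(1/2+δ)}` (`δ > 0`) is false for every shift. -/

/-- In the box `m ∈ (M,2M]` with `-c ≤ M`, the argument `m(N+1) + c` is a positive integer. -/
theorem rankOne_pos (c : ℤ) (M N : ℕ) (hc : -c ≤ (M : ℤ)) :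
    ∀ m ∈ Ioc M (2 * M), Int.toNat ((m : ℤ) * ((N + 1 : ℕ) : ℤ) + c) ≠ 0 := by
  intro m hm
  rw [mem_Ioc] at hm
  have h1 : (M : ℤ) + 1 ≤ m := by exact_mod_cast hm.1
  have h2 : (2 : ℤ) ≤ ((N + 1 : ℕ) : ℤ) → ((M : ℤ) + 1) * 2 ≤ (m : ℤ) * ((N + 1 : ℕ) : ℤ) :=
    fun h2 => mul_le_mul h1 h2 (by norm_num) (by positivity)
  have h3 : (1 : ℤ) ≤ ((N + 1 : ℕ) : ℤ) → ((M : ℤ) + 1) * 1 ≤ (m : ℤ) * ((N + 1 : ℕ) : ℤ) :=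
    fun h3 => mul_le_mul h1 h3 (by norm_num) (by positivity)
  have h4 : (1 : ℤ) ≤ ((N + 1 : ℕ) : ℤ) := by push_cast; omega
  have h5 := h3 h4
  generalize (m : ℤ) * ((N + 1 : ℕ) : ℤ) = k at h5 ⊢
  omega

/-- Rank-one witness: the bilinear form equals `M` (every surviving term is `λ(k)² = 1`). -/
theorem rankOne_sum (c : ℤ) (M N : ℕ) (hN : 1 ≤ N) (hc : -c ≤ (M : ℤ)) :
    ∑ m ∈ Ioc M (2 * M), ∑ n ∈ Ioc N (2 * N),
      lam (Int.toNat ((m : ℤ) * ((N + 1 : ℕ) : ℤ) + c)) * (if n = N + 1 then (1 : ℝ) else 0) *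
        lam (Int.toNat ((m : ℤ) * n + c)) = M := by
  have hmem : N + 1 ∈ Ioc N (2 * N) := by rw [mem_Ioc]; omega
  calc ∑ m ∈ Ioc M (2 * M), ∑ n ∈ Ioc N (2 * N),
      lam (Int.toNat ((m : ℤ) * ((N + 1 : ℕ) : ℤ) + c)) * (if n = N + 1 then (1 : ℝ) else 0) *
        lam (Int.toNat ((m : ℤ) * n + c))
      = ∑ m ∈ Ioc M (2 * M), (1 : ℝ) := by
        refine sum_congr rfl fun m hm => ?_
        rw [sum_eq_single_of_mem (N + 1) hmem (fun n _ hne => by simp [hne])]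
        rw [if_pos rfl, mul_one, lam_mul_self (rankOne_pos c M N hc m hm)]
    _ = M := by simp only [sum_const, card_Ioc_two_mul, nsmul_eq_mul, mul_one]

/-- Rank-one witness: `‖α‖₂² = M`. -/
theorem rankOne_alpha_sq (c : ℤ) (M N : ℕ) (hc : -c ≤ (M : ℤ)) :
    ∑ m ∈ Ioc M (2 * M), lam (Int.toNat ((m : ℤ) * ((N + 1 : ℕ) : ℤ) + c)) ^ 2 = M := by
  rw [sum_congr rfl fun m hm => lam_sq (rankOne_pos c M N hc m hm)]
  simp only [sum_const, card_Ioc_two_mul, nsmul_eq_mul, mul_one]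

/-- Rank-one witness: `‖β‖₂² = 1` (`β = δ_{N+1}`, and `N+1 ∈ (N,2N]` for `N ≥ 1`). -/
theorem rankOne_beta_sq (N : ℕ) (hN : 1 ≤ N) :
    ∑ n ∈ Ioc N (2 * N), (if n = N + 1 then (1 : ℝ) else 0) ^ 2 = 1 := by
  have hmem : N + 1 ∈ Ioc N (2 * N) := by rw [mem_Ioc]; omega
  rw [sum_eq_single_of_mem (N + 1) hmem (fun n _ hne => by simp [hne])]
  simp

/-- TIGHTNESS (b): in every box the ratio `|B| / (‖α‖₂‖β‖₂√(MN))` reaches `N^{-1/2}`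
(here for `-c ≤ M`, which covers every `c ≥ 0` and all large boxes). -/
theorem rankOne_ratio (c : ℤ) (M N : ℕ) (hN : 1 ≤ N) (hc : -c ≤ (M : ℤ)) :
    |∑ m ∈ Ioc M (2 * M), ∑ n ∈ Ioc N (2 * N),
      lam (Int.toNat ((m : ℤ) * ((N + 1 : ℕ) : ℤ) + c)) * (if n = N + 1 then (1 : ℝ) else 0) *
        lam (Int.toNat ((m : ℤ) * n + c))| = M ∧
    Real.sqrt (∑ m ∈ Ioc M (2 * M), lam (Int.toNat ((m : ℤ) * ((N + 1 : ℕ) : ℤ) + c)) ^ 2) *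
      Real.sqrt (∑ n ∈ Ioc N (2 * N), (if n = N + 1 then (1 : ℝ) else 0) ^ 2) *
      Real.sqrt ((M : ℝ) * N) * (N : ℝ) ^ (-(1 / 2 : ℝ)) = M := by
  refine ⟨by rw [rankOne_sum c M N hN hc]; exact abs_of_nonneg (Nat.cast_nonneg M), ?_⟩
  rw [rankOne_alpha_sq c M N hc, rankOne_beta_sq N hN, Real.sqrt_one, mul_one]
  have hMpos : (0 : ℝ) ≤ M := Nat.cast_nonneg M
  have hNpos : (0 : ℝ) < N := by exact_mod_cast hN
  rw [Real.sqrt_mul hMpos, show Real.sqrt (M : ℝ) * (Real.sqrt M * Real.sqrt N) * (N : ℝ) ^ (-(1 / 2 : ℝ))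
    = (Real.sqrt (M : ℝ) * Real.sqrt M) * (Real.sqrt N * (N : ℝ) ^ (-(1 / 2 : ℝ))) by ring,
    Real.mul_self_sqrt hMpos, Real.sqrt_eq_rpow, ← Real.rpow_add hNpos]
  norm_num

/-- STRENGTHENING (S1) of the crux's shape: diagonal term `N^{-(1/2+δ)}` with `δ > 0`. -/
def TypeIIShapeStrongN (f : ℕ → ℝ) (c : ℤ) : Prop :=
  ∃ η : ℝ, 0 < η ∧ ∃ δ : ℝ, 0 < δ ∧ ∃ C : ℝ, ∀ M N : ℕ, 1 ≤ N → N ≤ M → ∀ α β : ℕ → ℝ,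
    |∑ m ∈ Ioc M (2 * M), ∑ n ∈ Ioc N (2 * N), α m * β n * f (Int.toNat ((m : ℤ) * n + c))| ≤
      C * Real.sqrt (∑ m ∈ Ioc M (2 * M), α m ^ 2) * Real.sqrt (∑ n ∈ Ioc N (2 * N), β n ^ 2) *
        Real.sqrt ((M : ℝ) * N) * ((N : ℝ) ^ (-(1 / 2 + δ : ℝ)) + (M : ℝ) ^ (-η))

/-- (S1) is false for `λ` and EVERY shift `c` (rank-one witness; `N → ∞` then `M → ∞`). -/
theorem not_typeIIShapeStrongN_lam (c : ℤ) : ¬ TypeIIShapeStrongN lam c := by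
  rintro ⟨η, hη, δ, hδ, C, h⟩
  obtain ⟨N, hN1, hNa⟩ := ((eventually_ge_atTop 1).and
    (eventually_const_mul_rpow_neg_lt C hδ one_half_pos tendsto_natCast_atTop_atTop)).exists
  obtain ⟨M, hMN, hMc, hMb⟩ := ((eventually_ge_atTop N).and ((eventually_ge_atTop (Int.toNat (-c))).and
    (eventually_const_mul_rpow_neg_lt (C * Real.sqrt N) hη one_half_pos
      tendsto_natCast_atTop_atTop))).exists
  have hc : -c ≤ (M : ℤ) := by have := Int.self_le_toNat (-c); omega
  have hbox := h M N hN1 hMN (fun m => lam (Int.toNat ((m : ℤ) * ((N + 1 : ℕ) : ℤ) + c)))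
    (fun n => if n = N + 1 then (1 : ℝ) else 0)
  beta_reduce at hbox
  rw [rankOne_sum c M N hN1 hc, rankOne_alpha_sq c M N hc, rankOne_beta_sq N hN1,
    Real.sqrt_one, mul_one] at hbox
  have hMpos : (0 : ℝ) < M := by exact_mod_cast (hN1.trans hMN)
  have hNpos : (0 : ℝ) < N := by exact_mod_cast hN1
  have hsN : Real.sqrt (N : ℝ) * (N : ℝ) ^ (-(1 / 2 + δ : ℝ)) = (N : ℝ) ^ (-δ) := by
    rw [Real.sqrt_eq_rpow, ← Real.rpow_add hNpos]; congr 1; ring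
  have hrhs : C * Real.sqrt (M : ℝ) * Real.sqrt ((M : ℝ) * N) *
      ((N : ℝ) ^ (-(1 / 2 + δ : ℝ)) + (M : ℝ) ^ (-η)) =
      (M : ℝ) * (C * (N : ℝ) ^ (-δ) + C * Real.sqrt N * (M : ℝ) ^ (-η)) := by
    rw [Real.sqrt_mul hMpos.le, ← hsN]
    have := Real.mul_self_sqrt hMpos.le
    calc C * Real.sqrt (M : ℝ) * (Real.sqrt M * Real.sqrt N) *
        ((N : ℝ) ^ (-(1 / 2 + δ : ℝ)) + (M : ℝ) ^ (-η))
        = (Real.sqrt (M : ℝ) * Real.sqrt M) * (C * (Real.sqrt N * (N : ℝ) ^ (-(1 / 2 + δ : ℝ))) +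
            C * Real.sqrt N * (M : ℝ) ^ (-η)) := by ring
      _ = _ := by rw [this]
  rw [hrhs, abs_of_nonneg hMpos.le] at hbox
  nlinarith

/-- The crux with the diagonal term improved (for `c ≠ 0`). -/
def TypeIILiouvilleStrongN : Prop := ∀ c : ℤ, c ≠ 0 → TypeIIShapeStrongN lam c

/-- TIGHTNESS (b), packaged: the diagonal term of the crux cannot be improved. -/
theorem not_typeIILiouvilleStrongN : ¬ TypeIILiouvilleStrongN :=
  fun h => not_typeIIShapeStrongN_lam 1 (h 1 one_ne_zero)

/-! ## §2(c) CARICATURE: the shape fails for the character `χ₄` at every shift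

`χ₄(mn+c)` depends only on `(m mod 4, n mod 4)`: a matrix of rank `≤ 4`. On `m ≡ 1 - c`,
`n ≡ 1 (mod 4)` it is identically `1`. So boundedness + complete multiplicativity + mean zero of
the weight cannot suffice for the crux (the Landau–Siegel caricature `λ ≈ χ` in Lean form). -/

/-- The primitive Dirichlet character mod 4, as a real weight. -/
def chi4 (k : ℕ) : ℝ := if k % 4 = 1 then 1 else if k % 4 = 3 then -1 else 0

/-- Indicator of the residue class `a mod 4`. -/
def indA (a : ℕ) (m : ℕ) : ℝ := if m % 4 = a then 1 else 0

/-- `indA a` is `{0,1}`-valued. -/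
theorem indA_sq (a m : ℕ) : indA a m ^ 2 = indA a m := by
  unfold indA; split <;> norm_num

/-- At least `L` elements of `(4L, 8L]` lie in any residue class mod 4. -/
theorem le_card_filter_mod_four (L a : ℕ) (ha4 : a < 4) :
    L ≤ ((Ioc (4 * L) (2 * (4 * L))).filter (fun m => m % 4 = a)).card := by
  -- representative `r = (a+3) % 4 + 1 ∈ {1,…,4}` of `a mod 4`; the elements `4(L+j) + r`, `j < L`
  have hinj : Set.InjOn (fun j => 4 * (L + j) + ((a + 3) % 4 + 1)) (range L : Set ℕ) := by
    intro x _ y _ hxy; simp only at hxy; omega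
  calc L = (range L).card := (card_range L).symm
    _ = ((range L).image (fun j => 4 * (L + j) + ((a + 3) % 4 + 1))).card :=
        (card_image_of_injOn hinj).symm
    _ ≤ _ := by
      apply card_le_card
      intro m hm
      simp only [mem_image, mem_range] at hm
      obtain ⟨j, hj, rfl⟩ := hm
      simp only [mem_filter, mem_Ioc]
      omega

/-- CARICATURE (c): the crux's shape is false for `χ₄` in place of `λ`, at EVERY shift `c`. -/
theorem not_typeIIShape_chi4 (c : ℤ) : ¬ TypeIIShape chi4 c := by
  rintro ⟨η, hη, C, h⟩
  -- the residue of `m`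
  set a : ℕ := Int.toNat ((1 - c) % 4) with ha_def
  have ha4 : a < 4 := by
    have := Int.emod_lt_of_pos (1 - c) (by norm_num : (0 : ℤ) < 4); omega
  have ha : (a : ℤ) = (1 - c) % 4 := by
    have := Int.emod_nonneg (1 - c) (by norm_num : (4 : ℤ) ≠ 0); omega
  -- parameters: N = 4 N', M = 4 M'
  have h4 : Tendsto (fun L : ℕ => ((4 * L : ℕ) : ℝ)) atTop atTop :=
    tendsto_natCast_atTop_atTop.comp
      (tendsto_atTop_mono (fun L => show id L ≤ 4 * L by dsimp only [id]; omega) tendsto_id)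
  obtain ⟨N', hN'1, hN'a⟩ := ((eventually_ge_atTop 1).and
    (eventually_const_mul_rpow_neg_lt C (by norm_num : (0 : ℝ) < 1 / 2)
      (by norm_num : (0 : ℝ) < 1 / 8) h4)).exists
  obtain ⟨M', hM'N, hM'c, hM'b⟩ := ((eventually_ge_atTop N').and
    ((eventually_ge_atTop (Int.toNat (-c))).and
    (eventually_const_mul_rpow_neg_lt C hη (by norm_num : (0 : ℝ) < 1 / 8) h4))).exists
  replace hN'a : C * ((4 * N' : ℕ) : ℝ) ^ (-(1 / 2 : ℝ)) < 1 / 8 := hN'a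
  replace hM'b : C * ((4 * M' : ℕ) : ℝ) ^ (-η) < 1 / 8 := hM'b
  have hbox := h (4 * M') (4 * N') (by omega) (by omega) (indA a) (indA 1)
  -- every surviving term is `1`
  have hterm : ∀ m ∈ Ioc (4 * M') (2 * (4 * M')), ∀ n ∈ Ioc (4 * N') (2 * (4 * N')),
      indA a m * indA 1 n * chi4 (Int.toNat ((m : ℤ) * n + c)) = indA a m * indA 1 n := by
    intro m hm n hn
    rw [mem_Ioc] at hm hn
    by_cases hma : m % 4 = a
    · by_cases hnb : n % 4 = 1
      · have hk : (m * n) % 4 = a := by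
          rw [Nat.mul_mod, hma, hnb, mul_one, Nat.mod_eq_of_lt ha4]
        have hmn : (m : ℤ) ≤ (m : ℤ) * n :=
          le_mul_of_one_le_right (by positivity) (by exact_mod_cast (show 1 ≤ n by omega))
        have hm1 : 4 * (M' : ℤ) + 1 ≤ m := by exact_mod_cast hm.1
        have h1 : (Int.toNat ((m : ℤ) * n + c)) % 4 = 1 := by
          have hcast : (m : ℤ) * n = ((m * n : ℕ) : ℤ) := by push_cast; ring
          rw [hcast] at hmn ⊢
          generalize m * n = K at hk hmn ⊢
          omega
        simp [chi4, h1]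
      · simp [indA, hnb]
    · simp [indA, hma]
  have hsum : ∑ m ∈ Ioc (4 * M') (2 * (4 * M')), ∑ n ∈ Ioc (4 * N') (2 * (4 * N')),
      indA a m * indA 1 n * chi4 (Int.toNat ((m : ℤ) * n + c)) =
      (((Ioc (4 * M') (2 * (4 * M'))).filter (fun m => m % 4 = a)).card : ℝ) *
      (((Ioc (4 * N') (2 * (4 * N'))).filter (fun n => n % 4 = 1)).card : ℝ) := by
    rw [sum_congr rfl fun m hm => sum_congr rfl fun n hn => hterm m hm n hn, ← sum_mul_sum]
    simp only [indA, sum_boole]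
  have hsqA : ∑ m ∈ Ioc (4 * M') (2 * (4 * M')), indA a m ^ 2 =
      (((Ioc (4 * M') (2 * (4 * M'))).filter (fun m => m % 4 = a)).card : ℝ) := by
    simp only [indA_sq]; simp only [indA, sum_boole]
  have hsqB : ∑ n ∈ Ioc (4 * N') (2 * (4 * N')), indA 1 n ^ 2 =
      (((Ioc (4 * N') (2 * (4 * N'))).filter (fun n => n % 4 = 1)).card : ℝ) := by
    simp only [indA_sq]; simp only [indA, sum_boole]
  rw [hsum, hsqA, hsqB] at hbox
  -- abbreviations
  set x : ℝ := (((Ioc (4 * M') (2 * (4 * M'))).filter (fun m => m % 4 = a)).card : ℝ) with hx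
  set y : ℝ := (((Ioc (4 * N') (2 * (4 * N'))).filter (fun n => n % 4 = 1)).card : ℝ) with hy
  have hxM : (M' : ℝ) ≤ x := by rw [hx]; exact_mod_cast le_card_filter_mod_four M' a ha4
  have hyN : (N' : ℝ) ≤ y := by rw [hy]; exact_mod_cast le_card_filter_mod_four N' 1 (by norm_num)
  have hM'pos : (0 : ℝ) < M' := by exact_mod_cast (hN'1.trans hM'N)
  have hN'pos : (0 : ℝ) < N' := by exact_mod_cast hN'1
  have hxpos : 0 < x := hM'pos.trans_le hxM
  have hypos : 0 < y := hN'pos.trans_le hyN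
  -- `P = √(MN) = 4 t`, `t = √M' √N'`, and `s = √x √y ≥ t`
  have hP : Real.sqrt (((4 * M' : ℕ) : ℝ) * ((4 * N' : ℕ) : ℝ)) = 4 * (Real.sqrt M' * Real.sqrt N') := by
    push_cast
    rw [show (4 : ℝ) * M' * (4 * N') = (4 * 4) * ((M' : ℝ) * N') by ring,
      Real.sqrt_mul (by norm_num), Real.sqrt_mul_self (by norm_num), Real.sqrt_mul hM'pos.le]
  have hst : Real.sqrt M' * Real.sqrt N' ≤ Real.sqrt x * Real.sqrt y :=
    mul_le_mul (Real.sqrt_le_sqrt hxM) (Real.sqrt_le_sqrt hyN) (Real.sqrt_nonneg _)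
      (Real.sqrt_nonneg _)
  have htpos : 0 < Real.sqrt M' * Real.sqrt N' :=
    mul_pos (Real.sqrt_pos.mpr hM'pos) (Real.sqrt_pos.mpr hN'pos)
  have hspos : 0 < Real.sqrt x * Real.sqrt y := htpos.trans_le hst
  rw [hP, abs_of_nonneg (by positivity)] at hbox
  -- `x y = s²`, so the shape gives `s ≤ 4 t (C X)`
  have hxy : x * y = (Real.sqrt x * Real.sqrt y) * (Real.sqrt x * Real.sqrt y) := by
    rw [show Real.sqrt x * Real.sqrt y * (Real.sqrt x * Real.sqrt y) =
      (Real.sqrt x * Real.sqrt x) * (Real.sqrt y * Real.sqrt y) by ring,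
      Real.mul_self_sqrt hxpos.le, Real.mul_self_sqrt hypos.le]
  rw [hxy] at hbox
  have hs_le : Real.sqrt x * Real.sqrt y ≤ C * (4 * (Real.sqrt M' * Real.sqrt N')) *
      ((((4 * N' : ℕ) : ℝ)) ^ (-(1 / 2 : ℝ)) + (((4 * M' : ℕ) : ℝ)) ^ (-η)) := by
    refine le_of_mul_le_mul_left ?_ hspos
    calc Real.sqrt x * Real.sqrt y * (Real.sqrt x * Real.sqrt y)
        ≤ C * Real.sqrt x * Real.sqrt y * (4 * (Real.sqrt M' * Real.sqrt N')) *
          ((((4 * N' : ℕ) : ℝ)) ^ (-(1 / 2 : ℝ)) + (((4 * M' : ℕ) : ℝ)) ^ (-η)) := hbox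
      _ = Real.sqrt x * Real.sqrt y * (C * (4 * (Real.sqrt M' * Real.sqrt N')) *
          ((((4 * N' : ℕ) : ℝ)) ^ (-(1 / 2 : ℝ)) + (((4 * M' : ℕ) : ℝ)) ^ (-η))) := by ring
  nlinarith

end Summit.Parity.GeneralizedHardyLittlewood.Theorems.TypeIILiouville.Negative
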